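import Summits.Ventures.LatticeQCDFlow.Exactness.FlowSamplerAutocorrelation
import HarnessLib

/-!
# Which flows have a Gaussian minorant: bounded log-Jacobian and an affinely bounded inverse suffice

HONEST FRAMING: exact (Metropolis-corrected) sampling algorithms for lattice gauge theory;
figures of merit are autocorrelation/cost numbers at stated couplings and volumes; no
continuum-physics claim.  (SCALAR calibration rung S0-A: not a gauge result.)

Venture `LatticeQCDFlow` (cell pub-lqcd), topic `Exactness`; FANOUT row 2 (`s0-phi4`, FLOW arm).
NEW WORK of the cell (elementary real analysis); nothing is cited as a fact.  Printed counterparts,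
named only: Dinh–Sohl-Dickstein–Bengio 2017 (real NVP: affine coupling layers, triangular
Jacobian `exp Σ s`), Albergo–Kanwar–Shanahan 2019 (their φ⁴ flows).

`Exactness/Phi4FlowSamplerGaussianMinorant.lean` and `Exactness/FlowSamplerAutocorrelation.lean`
(row 2) turn a GAUSSIAN MINORANT of the model density, `q̃(φ) ≥ c e^{−κ Σφ²}`, into uniform
ergodicity and `τ_int ≤ e^{K}/(cZ) − ½` for the exact φ⁴ flow sampler, and left "affine-coupling
flows with bounded log-scales and affinely bounded inverse have such a minorant" as a remark.  This
file makes the remark a lemma, with the flow entering only through three numbers: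

* hypotheses on the model density `q̃` of a flow `F` with inverse `G` and prior density `r`:
  (H1) the change-of-variables form `q̃(x) = r(G x) · jac(x)` (as an identity of functions — the
  Jacobian formula itself is the flow's business, `Exactness/FlowPushforward.lean`);
  (H2) a Gaussian lower bound on the prior, `r(z) ≥ c₀ e^{−Σ z²/2}` (equality for `N(0, I)`);
  (H3) a lower bound on the Jacobian factor, `jac ≥ j₀ > 0` (bounded log-scales: `j₀ = e^{−V s_max}`);
  (H4) an affinely bounded inverse in squared norm, `Σ (G x)² ≤ α Σ x² + β`;
* **`gaussian_minorant_of_flow_bounds`** — then `q̃(x) ≥ (c₀ j₀ e^{−β/2}) · e^{−(α/2) Σ x²}`;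
* **`phi4Flow_tauInt_le_of_flow_bounds`** — hence, for the φ⁴ flow sampler with such a model
  (`λ > 0`, any real `J`, `q̃ > 0` measurable, `∫ q̃ = 1`): every bounded observable has
  `τ_int ≤ e^{K}/(c₀ j₀ e^{−β/2} Z) − ½`, `K = (n+1)(Σ|J| + α/2)²/(4λ)` — the integrated
  autocorrelation time is bounded by an explicit function of `(s_max, α, β)`, the volume and the
  couplings; and (`phi4Flow_uniformly_ergodic_of_flow_bounds`) the chain is uniformly ergodic at
  rate `(1 − c₀ j₀ e^{−β/2} Z e^{−K})ᵗ`.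
NOT CLAIMED: that a given trained network satisfies (H3)–(H4) with useful constants (unclamped
scale networks need not), nor the Jacobian formula (H1) for any concrete architecture.
-/

namespace Summit.Ventures.LatticeQCDFlow.Exactness

open Real MeasureTheory Finset
open Summit.Ventures.LatticeQCDFlow.Scoring

variable {n : ℕ}

/-- **A Gaussian minorant from three flow bounds.**  `q̃ = (r ∘ G) · jac` with `r ≥ c₀ e^{−Σz²/2}`,
`jac ≥ j₀ > 0`, `Σ(Gx)² ≤ α Σx² + β` gives `q̃(x) ≥ c₀ j₀ e^{−β/2} · e^{−(α/2) Σ x²}`. -/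
theorem gaussian_minorant_of_flow_bounds {q r jac : (Fin (n + 1) → ℝ) → ℝ}
    {G : (Fin (n + 1) → ℝ) → (Fin (n + 1) → ℝ)} {c₀ j₀ α β : ℝ} (hc₀ : 0 ≤ c₀) (hj₀ : 0 ≤ j₀)
    (hq : ∀ x, q x = r (G x) * jac x)
    (hr : ∀ z, c₀ * Real.exp (-(∑ w, z w ^ 2) / 2) ≤ r z)
    (hjac : ∀ x, j₀ ≤ jac x)
    (hG : ∀ x, ∑ w, G x w ^ 2 ≤ α * ∑ w, x w ^ 2 + β) (x : Fin (n + 1) → ℝ) :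
    c₀ * j₀ * Real.exp (-β / 2) * Real.exp (-(α / 2 * ∑ w, x w ^ 2)) ≤ q x := by
  rw [hq x]
  have h1 : c₀ * Real.exp (-(α * ∑ w, x w ^ 2 + β) / 2) ≤ r (G x) := by
    refine le_trans ?_ (hr (G x))
    refine mul_le_mul_of_nonneg_left (Real.exp_le_exp.2 ?_) hc₀
    have := hG x
    linarith
  have hr0 : 0 ≤ r (G x) := le_trans (mul_nonneg hc₀ (Real.exp_pos _).le) (hr (G x))
  calc c₀ * j₀ * Real.exp (-β / 2) * Real.exp (-(α / 2 * ∑ w, x w ^ 2))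
      = (c₀ * Real.exp (-(α * ∑ w, x w ^ 2 + β) / 2)) * j₀ := by
        rw [mul_assoc (c₀ * j₀), ← Real.exp_add]
        have e : -β / 2 + -(α / 2 * ∑ w, x w ^ 2) = -(α * ∑ w, x w ^ 2 + β) / 2 := by ring
        rw [e]
        ring
    _ ≤ r (G x) * j₀ := mul_le_mul_of_nonneg_right h1 hj₀
    _ ≤ r (G x) * jac x := mul_le_mul_of_nonneg_left (hjac x) hr0

/-- **`τ_int` OF THE φ⁴ FLOW SAMPLER FROM THE FLOW'S THREE NUMBERS.**  `λ > 0`, any real `J`;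
model density `q̃ > 0` measurable with `∫ q̃ = 1` of the form (H1) with (H2)–(H4) and `c₀, j₀ > 0`.
Then for every bounded measurable observable, the stationary integrated autocorrelation time of
the exact flow sampler is at most `e^{K}/((c₀ j₀ e^{−β/2}) Z) − ½`, `K = (n+1)(Σ|J| + α/2)²/(4λ)`. -/
theorem phi4Flow_tauInt_le_of_flow_bounds {lam : ℝ} (hlam : 0 < lam)
    (J : Fin (n + 1) → Fin (n + 1) → ℝ) {q r jac : (Fin (n + 1) → ℝ) → ℝ}
    {G : (Fin (n + 1) → ℝ) → (Fin (n + 1) → ℝ)} {c₀ j₀ α β : ℝ} (hc₀ : 0 < c₀) (hj₀ : 0 < j₀)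
    (hq : ∀ x, q x = r (G x) * jac x)
    (hr : ∀ z, c₀ * Real.exp (-(∑ w, z w ^ 2) / 2) ≤ r z) (hjac : ∀ x, j₀ ≤ jac x)
    (hG : ∀ x, ∑ w, G x w ^ 2 ≤ α * ∑ w, x w ^ 2 + β)
    (hq0 : ∀ φ, 0 < q φ) (hqm : Measurable q) (hqi : Integrable q) (hq1 : ∫ φ, q φ = 1)
    {f : (Fin (n + 1) → ℝ) → ℝ} (hfm : Measurable f) {B : ℝ} (hfb : ∀ φ, |f φ| ≤ B) :
    tauInt (fun k => (∫ φ, (f φ - gibbsExpect J lam f)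
        * ((imhOpPhi4 J lam q)^[k] (fun ψ => f ψ - gibbsExpect J lam f)) φ * gibbsWeight J lam φ)
        / ∫ φ, (f φ - gibbsExpect J lam f) ^ 2 * gibbsWeight J lam φ)
      ≤ Real.exp ((n + 1) * (((∑ y, ∑ z, |J y z|) + α / 2) ^ 2 / (4 * lam)))
          / (c₀ * j₀ * Real.exp (-β / 2) * gibbsZ J lam) - 1 / 2 :=
  phi4Flow_tauInt_le_of_gaussian_minorant hlam J hq0 hqm hqi hq1 (by positivity)
    (gaussian_minorant_of_flow_bounds hc₀.le hj₀.le hq hr hjac hG) hfm hfb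

/-- **UNIFORM ERGODICITY OF THE φ⁴ FLOW SAMPLER FROM THE FLOW'S THREE NUMBERS**: same hypotheses;
the sampler is exact for `phi4GibbsMeasure J λ` and `|μKᵗ(A) − π(A)| ≤ (1 − c₀ j₀ e^{−β/2} Z e^{−K})ᵗ`
from every initial law. -/
theorem phi4Flow_uniformly_ergodic_of_flow_bounds {lam : ℝ} (hlam : 0 < lam)
    (J : Fin (n + 1) → Fin (n + 1) → ℝ) {q r jac : (Fin (n + 1) → ℝ) → ℝ}
    {G : (Fin (n + 1) → ℝ) → (Fin (n + 1) → ℝ)} {c₀ j₀ α β : ℝ} (hc₀ : 0 < c₀) (hj₀ : 0 < j₀)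
    (hq : ∀ x, q x = r (G x) * jac x)
    (hr : ∀ z, c₀ * Real.exp (-(∑ w, z w ^ 2) / 2) ≤ r z) (hjac : ∀ x, j₀ ≤ jac x)
    (hG : ∀ x, ∑ w, G x w ^ 2 ≤ α * ∑ w, x w ^ 2 + β)
    (hq0 : ∀ φ, 0 < q φ) (hqm : Measurable q) (hqi : Integrable q) (hq1 : ∫ φ, q φ = 1) :
    haveI := isProbabilityMeasure_flowModel hq0 hqi hq1
    ProbabilityTheory.Kernel.Invariant (phi4FlowKernel J lam q) (phi4GibbsMeasure J lam) ∧
      ∀ (μ : Measure (Fin (n + 1) → ℝ)) [IsProbabilityMeasure μ] (t : ℕ)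
        (A : Set (Fin (n + 1) → ℝ)),
        |((fun m : Measure (Fin (n + 1) → ℝ) => m.bind (phi4FlowKernel J lam q))^[t] μ).real A
            - (phi4GibbsMeasure J lam).real A|
          ≤ (1 - c₀ * j₀ * Real.exp (-β / 2) * gibbsZ J lam
              * Real.exp (-((n + 1) * (((∑ y, ∑ z, |J y z|) + α / 2) ^ 2 / (4 * lam))))) ^ t :=
  phi4FlowSampler_uniformly_ergodic_of_gaussian_minorant hlam J hq0 hqm hqi hq1 (by positivity)
    (gaussian_minorant_of_flow_bounds hc₀.le hj₀.le hq hr hjac hG)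

end Summit.Ventures.LatticeQCDFlow.Exactness
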